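import Mathlib
import HarnessLib
import Summits.AtomisticToContinuum.Crystallization.Theorems.FrustratedLawDichotomyTwoShellRigidityLsFitReplayDecode

/-!
# Two-shell rigidity, slot 3 · `SphericalLsFit` replay parameters (hcp) of the B-run of record

`prmHcp` = the integer parameters of the hcp fit run (brace level `B2 = ⌈7·S²/200⌉`; levels `F0L`, `OM2`, `V1K`, `V3K` = the extremes
certified over the 32 ω-sub-leaf fits — real readings α ≤ 0.08817, Ω ≤ 0.03314, V₁ ≤ 0.04194, V₃ ≤ 0.06745;
rational dial (α, Ω, V₁, V₃) = (221 / 2500, 83 / 2500, 21 / 500, 27 / 400) for `sphericalLsFit_hcp_of_checkAllF'`).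
decomp-a2c census-1 g22, kit j345739, `rig_fitgen.py`.
-/

namespace Summit.AtomisticToContinuum.Crystallization.Theorems

namespace Rig

/-- Parameters of the hcp fit run of record (`β = 7/200`, `θ = 1/100`, probes `ptab26`). -/
def prmHcp : FitPrm :=
  ⟨46522979852472055551633247109812061, 4872416948791802228, 1681390938377572080490430022965245604,
    ⟨6309445658558145531, 9846440559348323180, 10470271180667707755⟩,
    ⟨11191437318742394076, 15836018963818121580, 18595832380049671626⟩, ptab26⟩

end Rig

end Summit.AtomisticToContinuum.Crystallization.Theorems
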